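import Literature.AlgebraicGeometry.Motives.FiniteQuotient
import HarnessLib

/-!
# Descent of rational Hodge classes along a finite quotient `π : X → X/G`, from the transfer
# property of `π` in ONE degree (Bredon II.19.2 as a hypothesis on the given quotient)

Topic `Literature/AlgebraicGeometry/Motives`. `Motives/FiniteQuotient.lean` §4–§5 derive, for a
finite group `G` acting on a smooth projective `X` with smooth projective quotient `X/G`, that a
`G`-invariant rational `(p, q)`-class on `X` is `π^* d` for a rational `(p, q)`-class `d` on `X/G`
(`exists_rational_hodge_map_mk_eq`) — GRANTED the named fact
`bredon1997_quotient_cohomology_invariants` (the transfer for ALL finite quotients of compact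
Hausdorff locally contractible spaces), which enters only through its instance for `π(ℂ)`
(`transfer_mk`). This file records the same conclusions with that instance as the hypothesis:
"`π^* : Hⁱ((X/G)(ℂ); ℂ) → Hⁱ(X(ℂ); ℂ)` is injective and every `G`-invariant class is in its range"
in the one degree `i` used — so that quotients for which the transfer is PROVED (e.g. semi-free
actions with taut fixed locus, `AlgebraicTopology/SingularHomology/SemiFreeQuotientTransfer.lean`:
involutions, the reflection quotients of the Dwork pencil) descend rational Hodge classes
unconditionally.

* `isRationalClass_of_isRationalClass_map_mk_of_injective` — a class on `X/G` (smooth projective)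
  whose pull-back is rational is rational, from injectivity of `π^*` in that degree (universal
  coefficients and a `ℚ`-linear retraction, as in `FiniteQuotient` §4);
* `isOfHodgeType_map_mk_iff_of_injective` — Hodge types are detected by an injective `π^*`;
* `exists_rational_hodge_map_mk_eq_of_transfer` — the descent package from the transfer property
  in degree `i`.

Everything is proved; no named facts.

## References

* [Bredon1997] G. E. Bredon, *Sheaf Theory*, 2nd ed., GTM 170 (1997), II Thm. 19.2.
* [HatcherAT2002] A. Hatcher, *Algebraic Topology*, CUP 2002, §3.1 p. 198 (universal coefficients).
* [VoisinHodgeI2002] C. Voisin, *Hodge Theory and Complex Algebraic Geometry I*, §7.3.2.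
-/

noncomputable section

open CategoryTheory AlgebraicGeometry
open scoped TensorProduct
open Literature.AlgebraicGeometry.RelativeSpec

namespace Literature.AlgebraicGeometry.Motives

open Literature.AlgebraicTopology.SingularHomology Literature.AlgebraicGeometry.HodgeTheory

variable {X : SchemeOver ℂ} {G : Type} [Group G] [Finite G] (ρ : ActionOver X.hom G) [IsProper X.hom]
  (hcov : ∀ x : X.left, ∃ O : ρ.StableAffineOpens, x ∈ O.1)

/-- **A class on `X/G` whose pull-back to `X` is rational is rational**, for `X/G` smooth
projective, from injectivity of `π^*` in that degree: writing `d` as the complexification `t` of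
rational classes (universal coefficients, `ofRatClassBaseChange_surjective`), `(π^*_ℚ ⊗ ℂ) t` is the
complexification of `π^* d = a ⊗ 1`, hence `1 ⊗ a` (`ofRatClassBaseChange_injective`); `π^*_ℚ` is
injective (it complexifies to `π^*`), so `t = 1 ⊗ v` (`exists_eq_one_tmul_of_baseChange_eq_one_tmul`).
The proof of `FiniteQuotient.isRationalClass_of_isRationalClass_map_mk` with the transfer fact
replaced by the injectivity it supplies. [cite: Bredon1997, II Thm. 19.2] [cite: HatcherAT2002, §3.1 p. 198] -/
theorem isRationalClass_of_isRationalClass_map_mk_of_injective {m : ℕ}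
    (hY : IsSmoothProjective m (finiteQuotient ρ)) {i : ℕ}
    (hinj : Function.Injective (complexBetti.map (finiteQuotient.mk ρ hcov) i))
    {d : complexBetti (finiteQuotient ρ) i}
    (hd : IsRationalClass (complexBetti.map (finiteQuotient.mk ρ hcov) i d)) : IsRationalClass d := by
  set π := finiteQuotient.mk ρ hcov with hπ
  -- `d` is the complexification of a tensor `t`
  obtain ⟨t, rfl⟩ := ofRatClassBaseChange_surjective hY i d
  -- `π^* d = a ⊗ 1` with `a` rational
  obtain ⟨a, ha⟩ := (isRationalClass_iff_mem_range_ofRatClass _).1 hd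
  -- the rational pull-back `π^*_ℚ`
  let f : singularCohomology ℚ ℚ (ComplexPoints (finiteQuotient ρ)) i →ₗ[ℚ]
      singularCohomology ℚ ℚ (ComplexPoints X) i :=
    (singularCohomology.map ℚ ℚ (AlgPoints.mapContinuous (L := ℂ) π) i).hom
  have hnat : ∀ x, ofRatClassBaseChange (ComplexPoints X) i (f.baseChange ℂ x) =
      complexBetti.map π i (ofRatClassBaseChange (ComplexPoints (finiteQuotient ρ)) i x) :=
    fun x ↦ HodgeModel.ofRatClassBaseChange_baseChange_map π i x
  -- `π^*_ℚ` is injective: it complexifies to `π^*`, injective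
  have hfinj : Function.Injective f := by
    intro v w hvw
    have h1 : complexBetti.map π i (ofRatClass _ i v) = complexBetti.map π i (ofRatClass _ i w) := by
      rw [← one_smul ℂ (ofRatClass _ i v), ← one_smul ℂ (ofRatClass _ i w),
        ← ofRatClassBaseChange_tmul, ← ofRatClassBaseChange_tmul, ← hnat, ← hnat,
        LinearMap.baseChange_tmul, LinearMap.baseChange_tmul, hvw]
    exact ofRatClass_injective i (hinj h1)
  -- `(π^*_ℚ ⊗ ℂ) t = 1 ⊗ a`
  have hft : f.baseChange ℂ t = (1 : ℂ) ⊗ₜ a := by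
    apply ofRatClassBaseChange_injective (ComplexPoints X) i
    rw [hnat, ofRatClassBaseChange_tmul, one_smul, ha]
  obtain ⟨v, rfl⟩ := exists_eq_one_tmul_of_baseChange_eq_one_tmul f hfinj t a hft
  rw [ofRatClassBaseChange_tmul, one_smul]
  exact isRationalClass_ofRatClass v

/-- **Hodge types along an injective `π^*`**: for `X` and `X/G` smooth projective and `p + q = i`,
a class `d` on `X/G` is of type `(p, q)` iff `π^* d` is (pull-backs along morphisms of smooth
projective varieties preserve types, `IsOfHodgeType.map_of_isSmoothProjective`; injective
pull-backs detect them, `IsOfHodgeType.of_map_of_injective`). [cite: VoisinHodgeI2002, §7.3.2] -/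
theorem isOfHodgeType_map_mk_iff_of_injective {n m : ℕ} (hX : IsSmoothProjective n X)
    (hY : IsSmoothProjective m (finiteQuotient ρ)) {i p q : ℕ} (hpq : p + q = i)
    (hinj : Function.Injective (complexBetti.map (finiteQuotient.mk ρ hcov) i))
    (d : complexBetti (finiteQuotient ρ) i) :
    IsOfHodgeType n X i p q (complexBetti.map (finiteQuotient.mk ρ hcov) i d) ↔
      IsOfHodgeType m (finiteQuotient ρ) i p q d :=
  ⟨fun h ↦ IsOfHodgeType.of_map_of_injective hX hY (finiteQuotient.mk ρ hcov) hpq hinj h,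
    fun h ↦ h.map_of_isSmoothProjective hX hY (finiteQuotient.mk ρ hcov)⟩

/-- **The descent package from the transfer property in degree `i`**: for `X`, `X/G` smooth
projective, `p + q = i`, if `π^* : Hⁱ((X/G)(ℂ); ℂ) → Hⁱ(X(ℂ); ℂ)` is injective and every
`G`-invariant class is in its range (Bredon II.19.2 FOR THIS quotient, e.g. proved for semi-free
actions with taut fixed locus), then every `G`-invariant RATIONAL class `c` of type `(p, q)` on `X`
is `π^* d` for a rational class `d` of type `(p, q)` on `X/G`. [cite: Bredon1997, II Thm. 19.2]
[cite: VoisinHodgeI2002, §7.3.2] -/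
theorem exists_rational_hodge_map_mk_eq_of_transfer {n m : ℕ} (hX : IsSmoothProjective n X)
    (hY : IsSmoothProjective m (finiteQuotient ρ)) {i p q : ℕ} (hpq : p + q = i)
    (hT : Function.Injective (complexBetti.map (finiteQuotient.mk ρ hcov) i) ∧
      ∀ c : complexBetti X i, (∀ g : G, singularCohomology.map ℂ ℂ (pointsAction ρ g) i c = c) →
        c ∈ Set.range (complexBetti.map (finiteQuotient.mk ρ hcov) i))
    {c : complexBetti X i} (hcr : IsRationalClass c) (hct : IsOfHodgeType n X i p q c)
    (hc : ∀ g : G, singularCohomology.map ℂ ℂ (pointsAction ρ g) i c = c) :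
    ∃ d : complexBetti (finiteQuotient ρ) i, IsRationalClass d ∧
      IsOfHodgeType m (finiteQuotient ρ) i p q d ∧ complexBetti.map (finiteQuotient.mk ρ hcov) i d = c := by
  obtain ⟨d, hd⟩ := hT.2 c hc
  subst hd
  exact ⟨d, isRationalClass_of_isRationalClass_map_mk_of_injective ρ hcov hY hT.1 hcr,
    (isOfHodgeType_map_mk_iff_of_injective ρ hcov hX hY hpq hT.1 d).1 hct, rfl⟩

end Literature.AlgebraicGeometry.Motives

end
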